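import Literature.Analysis.FluidPDE.TaoAveragedRotDil
import Literature.Analysis.FluidPDE.TaoAveragedProfileTransport
import Literature.Analysis.FluidPDE.TaoAveragedFrequencyPieces
import Literature.Analysis.FluidPDE.TaoAveragedComposition
import HarnessLib

/-!
# Tao 2016, §3.2 ¶2 proved: basic cascade operators from the normalised complexified ones

T. Tao, *Finite time blowup for an averaged three-dimensional Navier–Stokes equation*,
J. Amer. Math. Soc. **29** (2016), 601–674 = arXiv:1402.0290v3 (held as `paper:arxiv-1402.0290`),
§3.2, pp. 15–16. This file discharges the named fact
`Literature.Analysis.FluidPDE.Tao2016.basicCascade_of_normalised` (`TaoAveragedCascadeSteps.lean`):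
**if every complexified basic cascade operator (3.6) with normalised profiles (3.7) is a complex
average of the Euler bilinear operator `B`, then so is every basic local cascade operator (3.1)**,
for `0 < ε₀ ≤ 1/4` (`basicCascade_of_normalised_holds`). The printed argument is followed:

1. *"By decomposing the `ψⱼ` … into finitely many (complex-valued) pieces"* — the smooth
   frequency partition of `TaoAveragedFrequencyPieces.lean` (pieces with `ψ̂` in balls
   `B(c_a, ε₀³/4)`, `c_a` in the annulus), and the **multilinear expansion**
   `⟨C(u,v),w⟩ = ∑_{a,b,c} ⟨C_{abc}(u,v),w⟩` of (3.1) into the complexified operators (3.6) of the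
   pieces (`basicCascadeForm_eq_sum_pieces`), which needs the **absolute convergence of the series
   (3.6)** for `u ∈ H¹⁰`, `v, w ∈ L²` (`summable_cplxCascade_term`: Tao p. 14, "from the Plancherel
   theorem … and Hölder", here `|⟨u, \overline{ψ_{n}}⟩| ≤ ((1+ε₀)ⁿρ₀)^{-10} ‖ψ‖_{L²} ‖u‖_{H¹⁰}` for
   `ψ̂` vanishing on `|ξ| < ρ₀`, `enorm_pairing_conjL2_dil_le`);
2. *"we have the freedom to rotate and dilate each of the `ξⱼ⁰` as we please. We shall select the
   normalisation (3.7)"* — `exists_normalising_rotDil` (`TaoAveragedProfileTransport.lean`) and the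
   conjugation of complex averages by fixed rotations and dilations
   (`IsComplexAverageOf.precomp`, `cplxBasicCascadeForm_transport`, `TaoAveragedRotDil.lean`);
3. the closure of complex averages of `B` under finite sums (`isComplexAverageOf_sum_eulerForm`,
   `TaoAveragedCascadeAssembly.lean`).

## §3.2 ¶3 proved: transitivity of complex averaging (`complexAverage_trans_holds`)

Tao, §3.2 ¶3, p. 16: "From this [the Leibniz bound], Fubini's theorem, and Hölder's inequality,
together with the observation that rotation and dilation operators normalise `𝓜₀ ⊗ ℂ`, we have
the following transitivity property: if `C₁` is a complex average of `C₂`, and `C₂` is a complex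
average of `C₃`, then `C₁` is a complex average of `C₃`." The named fact
`Literature.Analysis.FluidPDE.Tao2016.complexAverage_trans` (the case `C₃ = B`) is discharged
below (`complexAverage_trans_holds`) with the composite datum `𝒟₁.comp 𝒟₂` of
`TaoAveragedComposition.lean` (sample space `Ω₁ × Ω₂`, symbols `m₂ · m₁(λ₂⁻¹R₂⁻¹·)`, rotations
`R₂R₁`, dilations `λ₁λ₂`; (3.5) by the Leibniz bound, invariance of the seminorms and Tonelli):
its slots are `A₂ ∘ A₁` (`comp_slot`) and it averages `B` to
`∫_{Ω₁} ∫_{Ω₂} ⟨B(A₂A₁u, A₂A₁v), A₂A₁w⟩ dμ₂ dμ₁` (`comp_average_eulerForm`, Fubini via the absolute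
convergence of (3.4)); since the slots `A₁` preserve `H¹⁰_df ⊗ ℂ` (`memH10dfC_slot`), the inner
integral is `C₂(A₁u, A₁v, A₁w)` and the whole is `C₁(u, v, w)`.

## References

* T. Tao, J. Amer. Math. Soc. 29 (2016), 601–674, arXiv:1402.0290v3, Def. 3.1 p. 14, §3.2
  pp. 15–16 ((3.6), (3.7)). Key `Tao2016AveragedNS`.
-/

noncomputable section

open MeasureTheory Set Filter FourierTransform
open scoped ENNReal NNReal SchwartzMap ComplexConjugate

namespace Literature.Analysis.FluidPDE.Tao2016

/-! ### Expansion of the wavelets of a real profile into the wavelets of its complex pieces -/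

/-- If the complex pieces `φ_a` sum to the (complexified) real profile `ψ`, then every wavelet of
`ψ` is the sum of the conjugate complex wavelets of the pieces (the wavelets of `ψ` are real). [cite: Tao2016AveragedNS, §3.2 (3.6)] -/
theorem cascadeWavelet_eq_sum_pieces {ε₀ : ℝ} {ι : Type*} [Fintype ι] (ψ : 𝓢((EuclideanSpace ℝ (Fin 3)), (EuclideanSpace ℝ (Fin 3))))
    (φ : ι → 𝓢((EuclideanSpace ℝ (Fin 3)), (EuclideanSpace ℂ (Fin 3)))) (hφ : ∑ a, φ a = schwartzC ψ) (n : ℤ) :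
    cascadeWavelet ε₀ ψ n = ∑ a, conjL2 (cplxCascadeWavelet ε₀ (φ a) n) := by
  have hreal : conjL2 (cascadeWavelet ε₀ ψ n) = cascadeWavelet ε₀ ψ n :=
    (isReal_iff_conjL2_eq _).1 (isReal_cascadeWavelet ε₀ ψ n)
  rw [← hreal, ← conjL2_sum]
  congr 1
  unfold cascadeWavelet cplxCascadeWavelet
  rw [schwartzL2_eq_toLp, ← hφ, schwartz_toLp_sum, dil_sum]

/-- `⟨u, ψₙ⟩ = ∑_a ⟨u, \overline{φ_{a,n}}⟩`. [cite: Tao2016AveragedNS, §3.2 (3.6)] -/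
theorem pairing_cascadeWavelet_eq_sum {ε₀ : ℝ} {ι : Type*} [Fintype ι] (ψ : 𝓢((EuclideanSpace ℝ (Fin 3)), (EuclideanSpace ℝ (Fin 3))))
    (φ : ι → 𝓢((EuclideanSpace ℝ (Fin 3)), (EuclideanSpace ℂ (Fin 3)))) (hφ : ∑ a, φ a = schwartzC ψ) (n : ℤ) (u : L2C) :
    pairing u (cascadeWavelet ε₀ ψ n) = ∑ a, pairing u (conjL2 (cplxCascadeWavelet ε₀ (φ a) n)) := by
  rw [cascadeWavelet_eq_sum_pieces ψ φ hφ n, pairing_sum_right]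

/-- The `n`-th term of (3.1) expands trilinearly into the `n`-th terms of the complexified
operators (3.6) of the piece triples. [cite: Tao2016AveragedNS, §3.2 (3.6)] -/
theorem basicCascade_term_eq_sum {ε₀ : ℝ} {ι : Type*} [Fintype ι] (ψ : Fin 3 → 𝓢((EuclideanSpace ℝ (Fin 3)), (EuclideanSpace ℝ (Fin 3))))
    (φ : Fin 3 → ι → 𝓢((EuclideanSpace ℝ (Fin 3)), (EuclideanSpace ℂ (Fin 3)))) (hφ : ∀ j, ∑ a, φ j a = schwartzC (ψ j)) (n : ℤ) (u v w : L2C) :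
    pairing u (cascadeWavelet ε₀ (ψ 0) n) * pairing v (cascadeWavelet ε₀ (ψ 1) n) *
        pairing w (cascadeWavelet ε₀ (ψ 2) n) =
      ∑ abc : ι × ι × ι, pairing u (conjL2 (cplxCascadeWavelet ε₀ (φ 0 abc.1) n)) *
        pairing v (conjL2 (cplxCascadeWavelet ε₀ (φ 1 abc.2.1) n)) *
          pairing w (conjL2 (cplxCascadeWavelet ε₀ (φ 2 abc.2.2) n)) := by
  rw [pairing_cascadeWavelet_eq_sum _ _ (hφ 0), pairing_cascadeWavelet_eq_sum _ _ (hφ 1),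
    pairing_cascadeWavelet_eq_sum _ _ (hφ 2), Fintype.sum_prod_type]
  simp_rw [Fintype.sum_prod_type]
  rw [Finset.sum_mul_sum, Finset.sum_mul]
  refine Finset.sum_congr rfl fun a _ => ?_
  rw [Finset.sum_mul]
  refine Finset.sum_congr rfl fun b _ => ?_
  rw [Finset.mul_sum]

/-- **Multilinear expansion of a basic cascade form into the complexified forms of the pieces**:
`⟨C_ψ(u,v), w⟩ = ∑_{a,b,c} ⟨C_{φ_{1a},φ_{2b},φ_{3c}}(u,v), w⟩` as soon as each piece series (3.6)
converges absolutely (Tao p. 14: "it is an easy matter to ensure that the sum in (3.1) is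
absolutely convergent"). [cite: Tao2016AveragedNS, §3.2 (3.6)] -/
theorem basicCascadeForm_eq_sum_pieces {ε₀ : ℝ} {ι : Type*} [Fintype ι] (ψ : Fin 3 → 𝓢((EuclideanSpace ℝ (Fin 3)), (EuclideanSpace ℝ (Fin 3))))
    (φ : Fin 3 → ι → 𝓢((EuclideanSpace ℝ (Fin 3)), (EuclideanSpace ℂ (Fin 3)))) (hφ : ∀ j, ∑ a, φ j a = schwartzC (ψ j)) {u v w : L2C}
    (hsum : ∀ abc : ι × ι × ι, Summable fun n : ℤ =>
      (((1 + ε₀) ^ ((5 : ℝ) * (n : ℝ) / 2) : ℝ) : ℂ) *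
        (pairing u (conjL2 (cplxCascadeWavelet ε₀ (φ 0 abc.1) n)) *
          pairing v (conjL2 (cplxCascadeWavelet ε₀ (φ 1 abc.2.1) n)) *
            pairing w (conjL2 (cplxCascadeWavelet ε₀ (φ 2 abc.2.2) n)))) :
    basicCascadeForm ε₀ (ψ 0) (ψ 1) (ψ 2) u v w =
      ∑ abc : ι × ι × ι,
        cplxBasicCascadeForm ε₀ (φ 0 abc.1) (φ 1 abc.2.1) (φ 2 abc.2.2) u v w := by
  unfold basicCascadeForm cplxBasicCascadeForm
  rw [← Summable.tsum_finsetSum (fun abc _ => hsum abc)]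
  refine tsum_congr fun n => ?_
  rw [basicCascade_term_eq_sum ψ φ hφ n u v w, Finset.mul_sum]

/-! ### Absolute convergence of the series (3.6) -/

/-- Plancherel: `(∫ |ĝ|²)^{1/2} = ‖g‖_{L²}`. [folklore] -/
theorem lintegral_rpow_fourierFn_eq_enorm (g : L2C) :
    (∫⁻ ξ, ‖fourierFn g ξ‖ₑ ^ (2 : ℝ) ∂(volume : Measure (EuclideanSpace ℝ (Fin 3)))) ^ (1 / (2 : ℝ)) = ‖g‖ₑ := by
  have h := eLpNorm_eq_lintegral_rpow_enorm_toReal (p := (2 : ℝ≥0∞)) (μ := (volume : Measure (EuclideanSpace ℝ (Fin 3))))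
    (f := fourierFn g) two_ne_zero ENNReal.ofNat_ne_top
  simp only [ENNReal.toReal_ofNat] at h
  rw [← h, fourierFn, ← Lp.enorm_def, ← ofReal_norm, MeasureTheory.Lp.norm_fourier_eq, ofReal_norm]

/-- `‖u‖_{H¹⁰} = (∫ ((1+|ξ|²)⁵ |û|)²)^{1/2}`. [folklore] -/
theorem lintegral_weight_five_fourierFn_eq (u : L2C) :
    (∫⁻ ξ, (ENNReal.ofReal ((1 + ‖ξ‖ ^ 2) ^ (5 : ℝ)) * ‖fourierFn u ξ‖ₑ) ^ (2 : ℝ)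
        ∂(volume : Measure (EuclideanSpace ℝ (Fin 3)))) ^ (1 / (2 : ℝ)) =
      FunctionSpaces.eFourierSobolevNorm 10 u := by
  rw [eFourierSobolevNorm_eq]
  unfold sobolevWeightIntegral
  congr 1
  refine lintegral_congr fun ξ => ?_
  rw [ENNReal.mul_rpow_of_nonneg _ _ (by norm_num), ENNReal.rpow_two, ENNReal.rpow_two,
    ← ENNReal.ofReal_pow (by positivity), ← Real.rpow_natCast, ← Real.rpow_mul (by positivity)]
  norm_num

/-- `Dil_c` is an isometry of `L²` (`ℝ≥0∞` form). [cite: Tao2016AveragedNS, (1.11)] -/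
theorem enorm_dil {c : ℝ} (hc : 0 < c) (u : L2C) : ‖dil c u‖ₑ = ‖u‖ₑ := by
  rw [← ofReal_norm, norm_dil u hc, ofReal_norm]

/-- The `L²` Fourier transform of the class of a complex Schwartz field is its Fourier integral
(a.e.). [folklore] -/
theorem fourierFn_toLp_ae (φ : 𝓢((EuclideanSpace ℝ (Fin 3)), (EuclideanSpace ℂ (Fin 3)))) :
    fourierFn (φ.toLp 2 (volume : Measure (EuclideanSpace ℝ (Fin 3)))) =ᵐ[volume] 𝓕 (⇑φ) := by
  unfold fourierFn
  rw [SchwartzMap.toLp_fourier_eq]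
  exact SchwartzMap.coeFn_toLp _ _ _

/-- If `φ̂` vanishes on `{|ξ| < ρ₀}`, then `\widehat{Dil_c φ}` vanishes a.e. on `{|ξ| < cρ₀}`
(`c > 0`). [cite: Tao2016AveragedNS, (1.11)] -/
theorem fourierFn_dil_toLp_eq_zero {φ : 𝓢((EuclideanSpace ℝ (Fin 3)), (EuclideanSpace ℂ (Fin 3)))} {ρ₀ : ℝ}
    (hφ : ∀ ξ : (EuclideanSpace ℝ (Fin 3)), ‖ξ‖ < ρ₀ → 𝓕 (⇑φ) ξ = 0) {c : ℝ} (hc : 0 < c) :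
    ∀ᵐ ξ ∂(volume : Measure (EuclideanSpace ℝ (Fin 3))), ‖ξ‖ < c * ρ₀ →
      fourierFn (dil c (φ.toLp 2 (volume : Measure (EuclideanSpace ℝ (Fin 3))))) ξ = 0 := by
  have hq : Measure.QuasiMeasurePreserving (fun ξ : (EuclideanSpace ℝ (Fin 3)) => c⁻¹ • ξ) volume volume :=
    Measure.quasiMeasurePreserving_smul volume (inv_ne_zero hc.ne')
  filter_upwards [fourierFn_dil (φ.toLp 2) hc, hq.ae_eq (fourierFn_toLp_ae φ)] with ξ h1 h2 hξ
  simp only [Function.comp_apply] at h2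
  rw [h1, h2, hφ _ ?_, smul_zero]
  rw [norm_smul, Real.norm_of_nonneg (inv_nonneg.2 hc.le), inv_mul_lt_iff₀ hc]
  exact hξ

/-- **Decay of the wavelet coefficients of an `H¹⁰` field** (Tao p. 14, "from the Plancherel
theorem"): if `φ̂` vanishes on `{|ξ| < ρ₀}`, `ρ₀ > 0`, then for `c > 0`
`|⟨u, \overline{Dil_c φ}⟩| ≤ (cρ₀)^{-10} ‖φ‖_{L²} ‖u‖_{H¹⁰}` (Cauchy–Schwarz on the Fourier side,
where `\widehat{Dil_c φ}` lives on `|ξ| ≥ cρ₀`). Stated in `ℝ≥0∞`. [cite: Tao2016AveragedNS, Def. 3.1 p. 14] -/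
theorem enorm_pairing_conjL2_dil_le {φ : 𝓢((EuclideanSpace ℝ (Fin 3)), (EuclideanSpace ℂ (Fin 3)))} {ρ₀ : ℝ} (hρ₀ : 0 < ρ₀)
    (hφ : ∀ ξ : (EuclideanSpace ℝ (Fin 3)), ‖ξ‖ < ρ₀ → 𝓕 (⇑φ) ξ = 0) {c : ℝ} (hc : 0 < c) (u : L2C) :
    ‖pairing u (conjL2 (dil c (φ.toLp 2 (volume : Measure (EuclideanSpace ℝ (Fin 3))))))‖ₑ ≤
      ENNReal.ofReal (((c * ρ₀) ^ 10)⁻¹) *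
        (‖φ.toLp 2 (volume : Measure (EuclideanSpace ℝ (Fin 3)))‖ₑ * FunctionSpaces.eFourierSobolevNorm 10 u) := by
  set g : L2C := dil c (φ.toLp 2) with hg
  set K₀ : ℝ≥0∞ := ENNReal.ofReal (((c * ρ₀) ^ 10)⁻¹) with hK₀
  set W : (EuclideanSpace ℝ (Fin 3)) → ℝ≥0∞ := fun ξ => ENNReal.ofReal ((1 + ‖ξ‖ ^ 2) ^ (5 : ℝ)) with hW
  have hWmeas : Measurable W := by
    rw [hW]
    fun_prop
  have hFmeas : ∀ v : L2C, AEMeasurable (fun ξ => ‖fourierFn v ξ‖ₑ) volume := fun v =>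
    (Lp.aestronglyMeasurable _).aemeasurable.enorm
  rw [pairing_conjL2_eq_inner, inner_eq_integral_fourierFn]
  -- pointwise: on the support `1 ≤ K₀ W`, off it `ĝ = 0`
  have hpt : ∀ᵐ ξ ∂(volume : Measure (EuclideanSpace ℝ (Fin 3))),
      ‖inner ℂ (fourierFn g ξ) (fourierFn u ξ)‖ₑ ≤
        ‖fourierFn g ξ‖ₑ * (K₀ * (W ξ * ‖fourierFn u ξ‖ₑ)) := by
    filter_upwards [fourierFn_dil_toLp_eq_zero hφ hc] with ξ h0
    by_cases hin : c * ρ₀ ≤ ‖ξ‖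
    · have h1 : (1 : ℝ≥0∞) ≤ K₀ * W ξ := by
        rw [hK₀, hW, ← ENNReal.ofReal_mul (by positivity), ← ENNReal.ofReal_one]
        refine ENNReal.ofReal_le_ofReal ?_
        rw [inv_mul_eq_div, le_div_iff₀ (by positivity), one_mul]
        calc (c * ρ₀) ^ 10 ≤ ‖ξ‖ ^ 10 := pow_le_pow_left₀ (by positivity) hin 10
          _ = (‖ξ‖ ^ 2) ^ (5 : ℝ) := by
              rw [show (5 : ℝ) = ((5 : ℕ) : ℝ) by norm_num, Real.rpow_natCast]
              ring
          _ ≤ (1 + ‖ξ‖ ^ 2) ^ (5 : ℝ) :=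
              Real.rpow_le_rpow (by positivity) (by linarith [sq_nonneg ‖ξ‖]) (by norm_num)
      calc ‖inner ℂ (fourierFn g ξ) (fourierFn u ξ)‖ₑ
          ≤ ‖fourierFn g ξ‖ₑ * ‖fourierFn u ξ‖ₑ := by
            rw [← ofReal_norm, ← ofReal_norm, ← ofReal_norm, ← ENNReal.ofReal_mul (norm_nonneg _)]
            exact ENNReal.ofReal_le_ofReal (norm_inner_le_norm _ _)
        _ = ‖fourierFn g ξ‖ₑ * (1 * (1 * ‖fourierFn u ξ‖ₑ)) := by rw [one_mul, one_mul]
        _ ≤ ‖fourierFn g ξ‖ₑ * (K₀ * W ξ * (1 * ‖fourierFn u ξ‖ₑ)) := by gcongr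
        _ = ‖fourierFn g ξ‖ₑ * (K₀ * (W ξ * ‖fourierFn u ξ‖ₑ)) := by rw [one_mul, mul_assoc]
    · rw [hg, h0 (lt_of_not_ge hin), inner_zero_left, enorm_zero]
      exact zero_le
  calc ‖∫ ξ, inner ℂ (fourierFn g ξ) (fourierFn u ξ)‖ₑ
      ≤ ∫⁻ ξ, ‖inner ℂ (fourierFn g ξ) (fourierFn u ξ)‖ₑ := enorm_integral_le_lintegral_enorm _
    _ ≤ ∫⁻ ξ, ‖fourierFn g ξ‖ₑ * (K₀ * (W ξ * ‖fourierFn u ξ‖ₑ)) := lintegral_mono_ae hpt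
    _ = K₀ * ∫⁻ ξ, ((fun ξ => ‖fourierFn g ξ‖ₑ) * fun ξ => W ξ * ‖fourierFn u ξ‖ₑ) ξ := by
        rw [← lintegral_const_mul' _ _ ENNReal.ofReal_ne_top]
        exact lintegral_congr fun ξ => by simp only [Pi.mul_apply]; ring
    _ ≤ K₀ * ((∫⁻ ξ, ‖fourierFn g ξ‖ₑ ^ (2 : ℝ)) ^ (1 / (2 : ℝ)) *
          (∫⁻ ξ, (W ξ * ‖fourierFn u ξ‖ₑ) ^ (2 : ℝ)) ^ (1 / (2 : ℝ))) := by
        gcongr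
        exact ENNReal.lintegral_mul_le_Lp_mul_Lq volume Real.HolderConjugate.two_two (hFmeas g)
          (hWmeas.aemeasurable.mul (hFmeas u))
    _ = K₀ * (‖φ.toLp 2 (volume : Measure (EuclideanSpace ℝ (Fin 3)))‖ₑ * FunctionSpaces.eFourierSobolevNorm 10 u) := by
        rw [lintegral_rpow_fourierFn_eq_enorm, lintegral_weight_five_fourierFn_eq, hg, enorm_dil hc]

/-- The decay bound in real form, for `u` of finite `H¹⁰` norm. [cite: Tao2016AveragedNS, Def. 3.1 p. 14] -/
theorem norm_pairing_conjL2_dil_le_decay {φ : 𝓢((EuclideanSpace ℝ (Fin 3)), (EuclideanSpace ℂ (Fin 3)))} {ρ₀ : ℝ} (hρ₀ : 0 < ρ₀)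
    (hφ : ∀ ξ : (EuclideanSpace ℝ (Fin 3)), ‖ξ‖ < ρ₀ → 𝓕 (⇑φ) ξ = 0) {c : ℝ} (hc : 0 < c) {u : L2C}
    (hu : FunctionSpaces.eFourierSobolevNorm 10 u < ∞) :
    ‖pairing u (conjL2 (dil c (φ.toLp 2 (volume : Measure (EuclideanSpace ℝ (Fin 3))))))‖ ≤
      ((c * ρ₀) ^ 10)⁻¹ * ‖φ.toLp 2 (volume : Measure (EuclideanSpace ℝ (Fin 3)))‖ *
        (FunctionSpaces.eFourierSobolevNorm 10 u).toReal := by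
  have h := enorm_pairing_conjL2_dil_le hρ₀ hφ hc u
  have hfin : ENNReal.ofReal (((c * ρ₀) ^ 10)⁻¹) *
      (‖φ.toLp 2 (volume : Measure (EuclideanSpace ℝ (Fin 3)))‖ₑ * FunctionSpaces.eFourierSobolevNorm 10 u) ≠ ∞ :=
    ENNReal.mul_ne_top ENNReal.ofReal_ne_top (ENNReal.mul_ne_top enorm_ne_top hu.ne)
  have h' := ENNReal.toReal_mono hfin h
  rw [toReal_enorm] at h'
  refine h'.trans_eq ?_
  rw [ENNReal.toReal_mul, ENNReal.toReal_mul, ENNReal.toReal_ofReal (by positivity), toReal_enorm,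
    mul_assoc]

/-- The trivial bound `|⟨u, \overline{Dil_c g}⟩| ≤ ‖g‖ ‖u‖` (Cauchy–Schwarz, `Dil_c` unitary). [folklore] -/
theorem norm_pairing_conjL2_dil_le {c : ℝ} (hc : 0 < c) (g u : L2C) :
    ‖pairing u (conjL2 (dil c g))‖ ≤ ‖g‖ * ‖u‖ := by
  calc ‖pairing u (conjL2 (dil c g))‖ ≤ ‖dil c g‖ * ‖u‖ := norm_pairing_conjL2_le u (dil c g)
    _ = ‖g‖ * ‖u‖ := by rw [norm_dil g hc]

/-- The scale factor `(1+ε₀)^{5n/2}` of (3.1)/(3.6) has norm itself. [folklore] -/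
theorem norm_cascadeScale {ε₀ : ℝ} (hε : 0 < 1 + ε₀) (n : ℤ) :
    ‖(((1 + ε₀) ^ ((5 : ℝ) * (n : ℝ) / 2) : ℝ) : ℂ)‖ = (1 + ε₀) ^ ((5 : ℝ) * (n : ℝ) / 2) := by
  rw [Complex.norm_real, Real.norm_of_nonneg (Real.rpow_nonneg hε.le _)]

/-- `(1+ε₀)^{5n/2} = ((1+ε₀)^{5/2})ⁿ` for `n ∈ ℕ`. [folklore] -/
theorem cascadeScale_natCast {ε₀ : ℝ} (hε : 0 < 1 + ε₀) (n : ℕ) :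
    (1 + ε₀) ^ ((5 : ℝ) * ((n : ℤ) : ℝ) / 2) = ((1 + ε₀) ^ ((5 : ℝ) / 2)) ^ n := by
  rw [Int.cast_natCast, show (5 : ℝ) * (n : ℝ) / 2 = (5 : ℝ) / 2 * (n : ℝ) by ring,
    Real.rpow_mul hε.le, Real.rpow_natCast]

/-- `(1+ε₀)^{5(-n)/2} = ((1+ε₀)^{5/2})⁻ⁿ` for `n ∈ ℕ`. [folklore] -/
theorem cascadeScale_neg_natCast {ε₀ : ℝ} (hε : 0 < 1 + ε₀) (n : ℕ) :
    (1 + ε₀) ^ ((5 : ℝ) * ((-(n : ℤ) : ℤ) : ℝ) / 2) = (((1 + ε₀) ^ ((5 : ℝ) / 2))⁻¹) ^ n := by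
  rw [Int.cast_neg, Int.cast_natCast,
    show (5 : ℝ) * (-(n : ℝ)) / 2 = (5 : ℝ) / 2 * (-(n : ℝ)) by ring, Real.rpow_mul hε.le,
    Real.rpow_neg (Real.rpow_nonneg hε.le _), Real.rpow_natCast, inv_pow]

/-- **Absolute convergence of the complexified cascade series (3.6)** (Tao p. 14: "from the
Plancherel theorem … and the Hölder inequality it is an easy matter to ensure that the sum … is
absolutely convergent for any `u, v, w ∈ H¹⁰_df`"): if `φ̂₁` vanishes on `{|ξ| < ρ₀}` with
`ρ₀ > 0`, `u` has finite `H¹⁰` norm and `v, w ∈ L²`, then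
`∑ₙ (1+ε₀)^{5n/2} ⟨u, \overline{φ_{1,n}}⟩ ⟨v, \overline{φ_{2,n}}⟩ ⟨w, \overline{φ_{3,n}}⟩` converges
absolutely (geometric decay `(1+ε₀)^{-15n/2}` as `n → +∞` from the `H¹⁰` bound on the first
factor, `(1+ε₀)^{5n/2}` as `n → -∞` from Cauchy–Schwarz). [cite: Tao2016AveragedNS, Def. 3.1 p. 14] -/
theorem summable_cplxCascade_term {ε₀ : ℝ} (hε₀ : 0 < ε₀) {φ₁ : 𝓢((EuclideanSpace ℝ (Fin 3)), (EuclideanSpace ℂ (Fin 3)))} (φ₂ φ₃ : 𝓢((EuclideanSpace ℝ (Fin 3)), (EuclideanSpace ℂ (Fin 3))))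
    {ρ₀ : ℝ} (hρ₀ : 0 < ρ₀) (hφ₁ : ∀ ξ : (EuclideanSpace ℝ (Fin 3)), ‖ξ‖ < ρ₀ → 𝓕 (⇑φ₁) ξ = 0) {u : L2C}
    (hu : FunctionSpaces.eFourierSobolevNorm 10 u < ∞) (v w : L2C) :
    Summable fun n : ℤ => (((1 + ε₀) ^ ((5 : ℝ) * (n : ℝ) / 2) : ℝ) : ℂ) *
      (pairing u (conjL2 (cplxCascadeWavelet ε₀ φ₁ n)) *
        pairing v (conjL2 (cplxCascadeWavelet ε₀ φ₂ n)) *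
          pairing w (conjL2 (cplxCascadeWavelet ε₀ φ₃ n))) := by
  have hε : 0 < 1 + ε₀ := by linarith
  have hμ1 : 1 < 1 + ε₀ := by linarith
  have hμ0 : (1 + ε₀) ≠ 0 := hε.ne'
  have hρ0 : ρ₀ ≠ 0 := hρ₀.ne'
  -- bounds on the three pairings
  have hA_triv : ∀ n : ℤ, ‖pairing u (conjL2 (cplxCascadeWavelet ε₀ φ₁ n))‖ ≤
      ‖φ₁.toLp 2 (volume : Measure (EuclideanSpace ℝ (Fin 3)))‖ * ‖u‖ := fun n =>
    norm_pairing_conjL2_dil_le (zpow_pos hε n) _ _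
  have hA_dec : ∀ n : ℤ, ‖pairing u (conjL2 (cplxCascadeWavelet ε₀ φ₁ n))‖ ≤
      (((1 + ε₀) ^ n * ρ₀) ^ 10)⁻¹ * ‖φ₁.toLp 2 (volume : Measure (EuclideanSpace ℝ (Fin 3)))‖ *
        (FunctionSpaces.eFourierSobolevNorm 10 u).toReal := fun n =>
    norm_pairing_conjL2_dil_le_decay hρ₀ hφ₁ (zpow_pos hε n) hu
  have hB : ∀ n : ℤ, ‖pairing v (conjL2 (cplxCascadeWavelet ε₀ φ₂ n))‖ ≤
      ‖φ₂.toLp 2 (volume : Measure (EuclideanSpace ℝ (Fin 3)))‖ * ‖v‖ := fun n =>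
    norm_pairing_conjL2_dil_le (zpow_pos hε n) _ _
  have hC : ∀ n : ℤ, ‖pairing w (conjL2 (cplxCascadeWavelet ε₀ φ₃ n))‖ ≤
      ‖φ₃.toLp 2 (volume : Measure (EuclideanSpace ℝ (Fin 3)))‖ * ‖w‖ := fun n =>
    norm_pairing_conjL2_dil_le (zpow_pos hε n) _ _
  have hnorm : ∀ n : ℤ, ‖(((1 + ε₀) ^ ((5 : ℝ) * (n : ℝ) / 2) : ℝ) : ℂ) *
      (pairing u (conjL2 (cplxCascadeWavelet ε₀ φ₁ n)) *
        pairing v (conjL2 (cplxCascadeWavelet ε₀ φ₂ n)) *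
          pairing w (conjL2 (cplxCascadeWavelet ε₀ φ₃ n)))‖ =
      (1 + ε₀) ^ ((5 : ℝ) * (n : ℝ) / 2) *
        (‖pairing u (conjL2 (cplxCascadeWavelet ε₀ φ₁ n))‖ *
          ‖pairing v (conjL2 (cplxCascadeWavelet ε₀ φ₂ n))‖ *
            ‖pairing w (conjL2 (cplxCascadeWavelet ε₀ φ₃ n))‖) := fun n => by
    rw [norm_mul, norm_mul, norm_mul, norm_cascadeScale hε]
  refine Summable.of_norm (Summable.of_nat_of_neg ?_ ?_)
  · -- `n ≥ 0`: geometric decay with ratio `(1+ε₀)^{5/2} / (1+ε₀)^{10}`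
    have hq0 : 0 ≤ (1 + ε₀) ^ ((5 : ℝ) / 2) / (1 + ε₀) ^ 10 := by positivity
    have hq1 : (1 + ε₀) ^ ((5 : ℝ) / 2) / (1 + ε₀) ^ 10 < 1 := by
      rw [div_lt_one (by positivity), ← Real.rpow_natCast]
      exact Real.rpow_lt_rpow_of_exponent_lt hμ1 (by norm_num)
    refine Summable.of_nonneg_of_le (fun n => norm_nonneg _) (fun n => ?_)
      ((summable_geometric_of_lt_one hq0 hq1).mul_left
        ((ρ₀ ^ 10)⁻¹ * ‖φ₁.toLp 2 (volume : Measure (EuclideanSpace ℝ (Fin 3)))‖ *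
          (FunctionSpaces.eFourierSobolevNorm 10 u).toReal *
          (‖φ₂.toLp 2 (volume : Measure (EuclideanSpace ℝ (Fin 3)))‖ * ‖v‖) * (‖φ₃.toLp 2 (volume : Measure (EuclideanSpace ℝ (Fin 3)))‖ * ‖w‖)))
    rw [hnorm, cascadeScale_natCast hε]
    have hX0 : 0 ≤ (((1 + ε₀) ^ (n : ℤ) * ρ₀) ^ 10)⁻¹ * ‖φ₁.toLp 2 (volume : Measure (EuclideanSpace ℝ (Fin 3)))‖ *
        (FunctionSpaces.eFourierSobolevNorm 10 u).toReal := by positivity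
    have h3 := mul_le_mul (mul_le_mul (hA_dec n) (hB n) (norm_nonneg _) hX0) (hC n)
      (norm_nonneg _) (mul_nonneg hX0 (by positivity))
    refine (mul_le_mul_of_nonneg_left h3 (pow_nonneg (Real.rpow_nonneg hε.le _) n)).trans_eq ?_
    rw [zpow_natCast, mul_pow, ← pow_mul, div_pow, ← pow_mul, mul_comm n 10]
    field_simp
  · -- `n ≤ 0`: geometric decay with ratio `(1+ε₀)^{-5/2}`
    have hq0 : 0 ≤ ((1 + ε₀) ^ ((5 : ℝ) / 2))⁻¹ := by positivity
    have hq1 : ((1 + ε₀) ^ ((5 : ℝ) / 2))⁻¹ < 1 :=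
      inv_lt_one_of_one_lt₀ (Real.one_lt_rpow hμ1 (by norm_num))
    refine Summable.of_nonneg_of_le (fun n => norm_nonneg _) (fun n => ?_)
      ((summable_geometric_of_lt_one hq0 hq1).mul_left
        (‖φ₁.toLp 2 (volume : Measure (EuclideanSpace ℝ (Fin 3)))‖ * ‖u‖ * (‖φ₂.toLp 2 (volume : Measure (EuclideanSpace ℝ (Fin 3)))‖ * ‖v‖) *
          (‖φ₃.toLp 2 (volume : Measure (EuclideanSpace ℝ (Fin 3)))‖ * ‖w‖)))
    rw [hnorm, cascadeScale_neg_natCast hε]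
    have h3 := mul_le_mul (mul_le_mul (hA_triv (-(n : ℤ))) (hB (-(n : ℤ))) (norm_nonneg _)
      (by positivity)) (hC (-(n : ℤ))) (norm_nonneg _) (by positivity)
    exact (mul_le_mul_of_nonneg_left h3 (pow_nonneg hq0 n)).trans_eq (mul_comm _ _)

/-- A ball Fourier support `B(c₀, r)` with `r < |c₀|` keeps `φ̂` away from the origin: `φ̂ = 0` on
`{|ξ| < |c₀| - r}`. [folklore] -/
theorem HasBallFourierSupport.eq_zero_of_norm_lt {c₀ : (EuclideanSpace ℝ (Fin 3))} {r : ℝ} {φ : 𝓢((EuclideanSpace ℝ (Fin 3)), (EuclideanSpace ℂ (Fin 3)))}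
    (h : HasBallFourierSupport c₀ r φ) (ξ : (EuclideanSpace ℝ (Fin 3))) (hξ : ‖ξ‖ < ‖c₀‖ - r) : 𝓕 (⇑φ) ξ = 0 := by
  refine h ξ ?_
  rw [dist_eq_norm, ← norm_neg, neg_sub]
  linarith [norm_sub_norm_le c₀ ξ]

/-! ### The theorem -/

/-- `|ξⱼ⁰| ≤ 3/2` for the normalised base frequencies (3.7) (`|ξ₂⁰| = √2`). [cite: Tao2016AveragedNS, (3.7)] -/
theorem norm_xi0_le (j : Fin 3) : ‖xi0 j‖ ≤ 3 / 2 := by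
  have h2 : Real.sqrt 2 < 3 / 2 := (Real.sqrt_lt' (by norm_num)).2 (by norm_num)
  fin_cases j
  · show ‖xi0 0‖ ≤ 3 / 2
    rw [norm_xi0_zero]
    norm_num
  · show ‖xi0 1‖ ≤ 3 / 2
    exact (norm_xi0_one.le).trans h2.le
  · show ‖xi0 2‖ ≤ 3 / 2
    rw [norm_xi0_two]
    norm_num

/-- **Tao 2016, §3.2 ¶2, proved**: for `0 < ε₀ ≤ 1/4`, if every complexified basic cascade
operator (3.6) with normalised profiles (`ψ̂ⱼ ⊆ B(ξⱼ⁰, ε₀³)`, (3.7)) is a complex average of `B`,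
then so is every basic local cascade operator (3.1) with real Schwartz profiles whose Fourier
transforms live in the annulus `{1-2ε₀ ≤ |ξ| ≤ 1+2ε₀}`. Proof as printed (p. 15): decompose each
`ψⱼ` into finitely many complex pieces with `ψ̂` in balls `B(c_a, ε₀³/4)`, `c_a` in the annulus
(smooth partition of unity in frequency); expand (3.1) trilinearly into the complexified operators
of the piece triples (absolute convergence, p. 14); normalise each triple by per-slot rotations
(`SO(3)`) and dilations (factors `|ξⱼ⁰|/|c_a| ≤ 3`, so the pieces land in `B(ξⱼ⁰, ε₀³)`), which
conjugate complex averages of `B` into complex averages of `B`; and sum, complex averages of `B`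
being closed under finite sums. This discharges the named fact `basicCascade_of_normalised`. [cite: Tao2016AveragedNS, §3.2 pp. 15–16] -/
theorem basicCascade_of_normalised_holds : basicCascade_of_normalised := by
  refine ⟨1 / 4, by norm_num, fun ε₀ hε₀ hε₁ H ψ₁ ψ₂ ψ₃ h₁ h₂ h₃ => ?_⟩
  have hε : 0 < 1 + ε₀ := by linarith
  -- pieces of radius `r = ε₀³/4`
  set r : ℝ := ε₀ ^ 3 / 4 with hr
  have hr0 : 0 < r := by positivity
  have hr1 : r ≤ 1 / 256 := by
    rw [hr]
    nlinarith [pow_le_pow_left₀ hε₀.le hε₁ 3]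
  obtain ⟨ι, _, c, P, hc, hP, hPsum⟩ := exists_ball_pieces ε₀ hr0
  set ψ : Fin 3 → 𝓢((EuclideanSpace ℝ (Fin 3)), (EuclideanSpace ℝ (Fin 3))) := ![ψ₁, ψ₂, ψ₃] with hψ
  have hψann : ∀ j, HasAnnularFourierSupport ε₀ (ψ j) := by
    intro j
    fin_cases j
    exacts [h₁, h₂, h₃]
  set φ : Fin 3 → ι → 𝓢((EuclideanSpace ℝ (Fin 3)), (EuclideanSpace ℂ (Fin 3))) := fun j a => P a (schwartzC (ψ j)) with hφ
  have hφsum : ∀ j, ∑ a, φ j a = schwartzC (ψ j) := fun j =>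
    hPsum _ (hψann j).fourier_schwartzC_eq_zero
  have hφsupp : ∀ j a, HasBallFourierSupport (c a) r (φ j a) := fun j a =>
    hP a _ (hψann j).fourier_schwartzC_eq_zero
  -- geometry of the centres
  have hc_norm : ∀ a, 1 / 2 ≤ ‖c a‖ := fun a => by
    have := (hc a).1
    linarith
  have hc_ne : ∀ a, c a ≠ 0 := fun a h => by
    have := hc_norm a
    rw [h, norm_zero] at this
    linarith
  have hρ : ∀ a, 0 < ‖c a‖ - r := fun a => by linarith [hc_norm a]
  have hκr : ∀ (j : Fin 3) a, ‖xi0 j‖ / ‖c a‖ * r ≤ ε₀ ^ 3 := fun j a => by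
    have hκ : ‖xi0 j‖ / ‖c a‖ ≤ 3 := by
      rw [div_le_iff₀ (lt_of_lt_of_le (by norm_num) (hc_norm a))]
      linarith [norm_xi0_le j, hc_norm a]
    calc ‖xi0 j‖ / ‖c a‖ * r ≤ 3 * r := by gcongr
      _ ≤ ε₀ ^ 3 := by rw [hr]; linarith [pow_pos hε₀ 3]
  -- each piece triple gives a complex average of `B`
  have hpiece : ∀ abc : ι × ι × ι,
      IsComplexAverageOf (cplxBasicCascadeForm ε₀ (φ 0 abc.1) (φ 1 abc.2.1) (φ 2 abc.2.2))
        eulerForm := by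
    intro abc
    obtain ⟨R₀, φ₀', hdet₀, htoLp₀, hsupp₀⟩ :=
      exists_normalising_rotDil (hc_ne abc.1) (xi0_ne_zero 0) (φ 0 abc.1) (hφsupp 0 abc.1)
    obtain ⟨R₁, φ₁', hdet₁, htoLp₁, hsupp₁⟩ :=
      exists_normalising_rotDil (hc_ne abc.2.1) (xi0_ne_zero 1) (φ 1 abc.2.1) (hφsupp 1 abc.2.1)
    obtain ⟨R₂, φ₂', hdet₂, htoLp₂, hsupp₂⟩ :=
      exists_normalising_rotDil (hc_ne abc.2.2) (xi0_ne_zero 2) (φ 2 abc.2.2) (hφsupp 2 abc.2.2)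
    set κ : Fin 3 → ℝ := ![‖xi0 0‖ / ‖c abc.1‖, ‖xi0 1‖ / ‖c abc.2.1‖, ‖xi0 2‖ / ‖c abc.2.2‖]
      with hκ
    have hκpos : ∀ i, 0 < κ i := by
      intro i
      fin_cases i
      · exact div_pos (norm_pos_iff.2 (xi0_ne_zero 0)) (norm_pos_iff.2 (hc_ne _))
      · exact div_pos (norm_pos_iff.2 (xi0_ne_zero 1)) (norm_pos_iff.2 (hc_ne _))
      · exact div_pos (norm_pos_iff.2 (xi0_ne_zero 2)) (norm_pos_iff.2 (hc_ne _))
    set Rf : Fin 3 → ((EuclideanSpace ℝ (Fin 3)) ≃ₗᵢ[ℝ] (EuclideanSpace ℝ (Fin 3))) := ![R₀, R₁, R₂] with hRf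
    have hdet : ∀ i, LinearMap.det ((Rf i).toLinearEquiv : (EuclideanSpace ℝ (Fin 3)) →ₗ[ℝ] (EuclideanSpace ℝ (Fin 3))) = 1 := by
      intro i
      fin_cases i
      exacts [hdet₀, hdet₁, hdet₂]
    set φ' : Fin 3 → 𝓢((EuclideanSpace ℝ (Fin 3)), (EuclideanSpace ℂ (Fin 3))) := ![φ₀', φ₁', φ₂'] with hφ'
    set φp : Fin 3 → 𝓢((EuclideanSpace ℝ (Fin 3)), (EuclideanSpace ℂ (Fin 3))) := ![φ 0 abc.1, φ 1 abc.2.1, φ 2 abc.2.2] with hφp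
    have htoLp : ∀ i, (φ' i).toLp 2 (volume : Measure (EuclideanSpace ℝ (Fin 3))) =
        rot (Rf i) (dil (κ i) ((φp i).toLp 2 (volume : Measure (EuclideanSpace ℝ (Fin 3))))) := by
      intro i
      fin_cases i
      exacts [htoLp₀, htoLp₁, htoLp₂]
    have hnormalised : NormalisedProfiles ε₀ φ' := by
      intro j
      fin_cases j
      · exact hsupp₀.mono (hκr 0 _)
      · exact hsupp₁.mono (hκr 1 _)
      · exact hsupp₂.mono (hκr 2 _)
    have hH : IsComplexAverageOf (cplxBasicCascadeForm ε₀ (φ' 0) (φ' 1) (φ' 2)) eulerForm :=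
      H φ' hnormalised
    have htr := cplxBasicCascadeForm_transport hε φp φ' Rf κ hκpos htoLp
    exact (hH.precomp Rf κ hdet hκpos).of_eqOn fun u v w _ _ _ => htr u v w
  -- sum over the piece triples
  have havg := isComplexAverageOf_sum_eulerForm (Finset.univ : Finset (ι × ι × ι))
    (fun _ => (1 : ℂ))
    (fun abc => cplxBasicCascadeForm ε₀ (φ 0 abc.1) (φ 1 abc.2.1) (φ 2 abc.2.2))
    fun abc _ => hpiece abc
  refine havg.of_eqOn fun u v w hu hv hw => ?_
  have hsum : ∀ abc : ι × ι × ι, Summable fun n : ℤ =>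
      (((1 + ε₀) ^ ((5 : ℝ) * (n : ℝ) / 2) : ℝ) : ℂ) *
        (pairing u (conjL2 (cplxCascadeWavelet ε₀ (φ 0 abc.1) n)) *
          pairing v (conjL2 (cplxCascadeWavelet ε₀ (φ 1 abc.2.1) n)) *
            pairing w (conjL2 (cplxCascadeWavelet ε₀ (φ 2 abc.2.2) n))) := fun abc =>
    summable_cplxCascade_term hε₀ _ _ (hρ abc.1)
      ((hφsupp 0 abc.1).eq_zero_of_norm_lt) hu.1 v w
  calc basicCascadeForm ε₀ ψ₁ ψ₂ ψ₃ u v w = basicCascadeForm ε₀ (ψ 0) (ψ 1) (ψ 2) u v w := rfl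
    _ = ∑ abc : ι × ι × ι,
          cplxBasicCascadeForm ε₀ (φ 0 abc.1) (φ 1 abc.2.1) (φ 2 abc.2.2) u v w :=
        basicCascadeForm_eq_sum_pieces ψ φ hφsum hsum
    _ = ∑ abc : ι × ι × ι,
          (1 : ℂ) * cplxBasicCascadeForm ε₀ (φ 0 abc.1) (φ 1 abc.2.1) (φ 2 abc.2.2) u v w := by
        simp only [one_mul]

/-! ### §3.2 ¶3: transitivity of complex averaging -/

/-- **The slots of a complex average preserve `H¹⁰_df ⊗ ℂ`**: `m(D) Rot_R Dil_λ` maps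
`H¹⁰_df ⊗ ℂ` to itself (Tao p. 6: multipliers of order `0`, rotations and dilations are bounded
on `H¹⁰_df`; divergence-freeness is preserved). [cite: Tao2016AveragedNS, §1.1 p. 6 and Def. 3.4] -/
theorem ComplexAveragingDatum.memH10dfC_slot (𝒟 : ComplexAveragingDatum) (i : Fin 3) (θ : 𝒟.Ω)
    {u : L2C} (hu : MemH10dfC u) : MemH10dfC (𝒟.slot i θ u) :=
  ((hu.dil (𝒟.lam_pos i θ)).rot (𝒟.R i θ)).fourierMultiplier (𝒟.symbolLp i θ)

/-- **Discharge of `complexAverage_trans`** (Tao 2016, §3.2 ¶3, p. 16: transitivity of complex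
averaging, towards `B`): if `C₁` is a complex average of `C₂` and `C₂` is a complex average of
the Euler bilinear operator `B`, then `C₁` is a complex average of `B` — witnessed by the
composite datum `𝒟₁.comp 𝒟₂` (product sample space; "rotation and dilation operators normalise
`𝓜₀ ⊗ ℂ`" for the composite symbols; the Leibniz bound and Tonelli for (3.5); Fubini for (3.4)). [cite: Tao2016AveragedNS, §3.2 p. 16] -/
theorem complexAverage_trans_holds : complexAverage_trans := by
  intro C₁ C₂ h₁ h₂
  obtain ⟨𝒟₁, h₁⟩ := h₁
  obtain ⟨𝒟₂, h₂⟩ := h₂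
  refine ⟨𝒟₁.comp 𝒟₂, fun u v w hu hv hw => ?_⟩
  rw [h₁ u v w hu hv hw, 𝒟₁.comp_average_eulerForm 𝒟₂ hu.1 hv.1 w]
  change ∫ θ, C₂ (𝒟₁.slot 0 θ u) (𝒟₁.slot 1 θ v) (𝒟₁.slot 2 θ w) ∂𝒟₁.μ = _
  refine integral_congr_ae (Eventually.of_forall fun θ => ?_)
  exact h₂ _ _ _ (𝒟₁.memH10dfC_slot 0 θ hu) (𝒟₁.memH10dfC_slot 1 θ hv)
    (𝒟₁.memH10dfC_slot 2 θ hw)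

end Literature.Analysis.FluidPDE.Tao2016
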